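/-
Copyright: cell pub-balaban-gaps (YM BLITZ Y1, track G1), seat g1-p2 GEN 8 (unit `pub-balaban-gaps-g1-p2`).  Row (D4) NODE O,
JUNCTION J-3 (multi-level), GEOMETRY HALF: the blocks `𝔅 = ⋃_j Λ_j` of a nested family of domains of the torus `T_η` ([4] (2.1)–(2.4),
(2.45)) NEST INTO THE TOP CUBES (side `L^k` fine sites = `1`) of the seat's unit cube torus `UT`, and the multiscale distance (2.46)
(graph distance of the admissible bonds, `B6Geom246MultiLevelTorus.geomT`) DOMINATES the cube torus' ℓ¹ distance:
`d₁(Y(y), Y(y′)) ≤ (d+1)·d_T(y, y′)`.  HONEST FRAMING: finite-lattice bookkeeping over the lit-balaban lineage's carriers; nothing of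
Bałaban's constructed or asserted; (D4) NOT discharged (instance 0∕1); NOT BetaPertH, NOT continuum, NOT Clay.
-/
import Summits.QuantumFields.BalabanUV.Gaps.D4WalkBlockFlatLetters
import Literature.MathematicalPhysics.QuantumFieldTheory.Balaban1983to89.B6Geom246MultiLevelTorus

/-!
# `Gaps.D4WalkBlockMultiLevelGeometry` — junction J-3 (multi-level), geometry: the blocks of [4]'s nested domain family on
# the torus nest into the top cubes of the (D4) cube torus, and `d₁ ≤ (d+1)·d_T` (cell pub-balaban-gaps, seat g1-p2 gen 8)

HONEST DEPENDENCY (cell pub-balaban, verbatim): continuum YM on T⁴ ⇐ BetaPertH ∧ nine spine estimates (0/9 proved);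
BetaPertH ⇐ (D1) ∧ (D4) ∧ CAP+tail.

WHERE THIS SITS.  `D4WalkBlockFlatLetters` (57a) read the ONE-SCALE flat propagator of [4] Prop. 2.2 (`Ω_j = T_η` for all `j`,
p. 224) into the (D4) block currency `D4WalkBlock.blockNorm` over the unit cube torus `UT` with `tdist1`; its census row V86
left «the multi-level family {Ω_j} version (B6 `prop22_first∕second_multiLevelTorus` over `geomT D` — graph distance of
`bondT`; junction = bijection of top blocks + Chebyshev ≥ ℓ¹∕(d+1))».  THIS FILE is that geometry, for the lit-balaban
carriers of [4] (2.1)–(2.4) on the torus (`B6MultiLevelTorusOperator.TDomains d ℓ Mh k P R`: fine torus = the fundamental box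
`boxDom (N0 ℓ Mh k P)`, `N₀_μ = L^k·(L·M_h·P_μ)`, `L = ℓ + 1`; blocks `bset`, block map `blkOf`, touching relation `TouchT`,
bond graph `bondT`, geometry `geomT D` with `dist = (bondT D).dist`):
* §1 arithmetic of nesting: `circAbs_le_of_abs_sub_mul_le` ∕ `exists_abs_sub_mul_le_circAbs` (the circular distance to `Nℤ`),
  `abs_ediv_add_sub_ediv_le` (`|⌊(y+r)/B⌋ − ⌊y/B⌋| ≤ 1` for `|r| ≤ 1`), **`circAbs_ediv_le_one`**: a step of circular size `≤ 1`
  on `ℤ/(B·K)` is a step of circular size `≤ 1` on `ℤ/K` after integer division by `B` (one fine step moves the top cube by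
  at most one, with wrap-around);
* §2 the cube maps: `cubeOfLabel Kc z` (a label `z : Fin (d+1) → ℤ` read in `UT Kc`), **`cubeML`** (a fine site ↦ its top cube,
  `x ↦ ⌊x/L^k⌋`), **`topOf`** (a block `(j, y) ↦ ⌊y/L^{k−j}⌋`), **`topOf_blkOf`** (blocks nest: `topOf (blkOf x) = cubeML x`, by
  `blk_blk`), `cubeML_val` (no wrap inside the fundamental box when `N₀ = L^k·Kc`), the canonical choice `Kc = L·M_h·P`
  (`N0_eq_pow_mul_topCount`, `neZero_topCount`);
* §3 **`tdist1_cubeML_le_of_torusSupNorm_le_one`** (fine sites at torus sup-distance `≤ 1` have top cubes at `d₁ ≤ d + 1`),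
  **`tdist1_topOf_le_of_adj`** (admissible bond ⟹ `d₁ ≤ d + 1`), `tdist1_topOf_le_length` (along a bond walk),
  **`tdist1_topOf_le_dist`**: `d₁(topOf s, topOf t) ≤ (d+1)·d_T(s,t)` (bond graph connected: `connectedT`), and the exponential
  form **`exp_neg_dist_le`**: `e^{−δ·d_T(s,t)} ≤ e^{−(δ/(d+1))·d₁(topOf s, topOf t)}` for `δ ≥ 0`.
The analytic half (block letters of [4] Prop. 2.2's multi-level entries, k-uniform via Lemma 2.1 (2.61)) is the sibling
`D4WalkBlockFlatLettersMultiLevel`.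

References: T. Bałaban, Comm. Math. Phys. **96** (1984) 223–250 [4], (2.1)–(2.4) p. 224, (2.45)–(2.46) p. 231, Lemma 2.1 p. 234;
Comm. Math. Phys. **99** (1985) 389–434 [B9], Thm 3.10 (3.108) p. 416 (blocks `Δ(y), y ∈ Λ_j`).
-/

noncomputable section

namespace Summit.QuantumFields.BalabanUV.Gaps.D4WalkBlockMultiLevelGeometry

open Finset
open Literature.MathematicalPhysics.QuantumFieldTheory.Balaban1983to89
open Literature.MathematicalPhysics.QuantumFieldTheory.Balaban1983to89.B4Reflection242 (boxDom mem_boxDom blk)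
open Literature.MathematicalPhysics.QuantumFieldTheory.Balaban1983to89.B4Thm110ZeroBox (blk_blk)
open Literature.MathematicalPhysics.QuantumFieldTheory.Balaban1983to89.B4TorusKernel.MultiPeriod (circAbs circAbs_nonneg
  circAbs_add_mul circAbs_le_abs torusSupNorm)
open Literature.MathematicalPhysics.QuantumFieldTheory.Balaban1983to89.B4Sect5Torus (ccoord tdist ccoord_cast)
open Literature.MathematicalPhysics.QuantumFieldTheory.Balaban1983to89.B9Thm37GlueTorus (tdist1 tdist1_nonneg tdist1_triangle
  tdist1_self tdist1_comm)
open Literature.MathematicalPhysics.QuantumFieldTheory.Balaban1983to89.B5TorusCover (UT)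
open Literature.MathematicalPhysics.QuantumFieldTheory.Balaban1983to89.B6MultiLevelBoxOperator (N0 Domains)
open Literature.MathematicalPhysics.QuantumFieldTheory.Balaban1983to89.B6MultiLevelTorusOperator (TDomains)
open Literature.MathematicalPhysics.QuantumFieldTheory.Balaban1983to89.B6Geom246MultiLevelBox (bset blkOf blkOf_val
  exists_blkOf_eq scale_bounds)
open Literature.MathematicalPhysics.QuantumFieldTheory.Balaban1983to89.B6Geom246MultiLevelTorus (TouchT bondT bondT_adj
  connectedT geomT)

variable {d : ℕ}

/-! ## §1. Arithmetic of nesting: circular distances under integer division -/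

section Arith

/-- The circular size of `z` mod `n` is at most its distance to any multiple of `n`. -/
theorem circAbs_le_of_abs_sub_mul_le {n : ℕ} (hn : 1 ≤ n) (z m : ℤ) : circAbs n z ≤ |z - n * m| := by
  have e : z = (z - n * m) + n * m := by ring
  rw [e, circAbs_add_mul, ← e]
  exact circAbs_le_abs hn _

/-- Conversely the circular size is attained: some multiple of `n` is within `circAbs n z` of `z`. -/
theorem exists_abs_sub_mul_le_circAbs {n : ℕ} (hn : 1 ≤ n) (z : ℤ) : ∃ m : ℤ, |z - n * m| ≤ circAbs n z := by
  have hn0 : (0 : ℤ) < n := by exact_mod_cast hn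
  have hdiv : (n : ℤ) * (z / n) + z % n = z := Int.mul_ediv_add_emod z n
  have h0 : 0 ≤ z % n := Int.emod_nonneg z hn0.ne'
  have h1 : z % n < n := Int.emod_lt_of_pos z hn0
  unfold circAbs
  rcases le_total (z % (n : ℤ)) ((n : ℤ) - z % n) with h | h
  · refine ⟨z / n, ?_⟩
    rw [min_eq_left h, show z - n * (z / n) = z % n by linarith, abs_of_nonneg h0]
  · refine ⟨z / n + 1, ?_⟩
    rw [min_eq_right h, show z - n * (z / n + 1) = z % n - n by ring_nf; linarith, abs_of_nonpos (by linarith)]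
    linarith

/-- `⌊(y+1)/B⌋ − ⌊y/B⌋ ∈ {0, 1}` for `B ≥ 1`. -/
theorem ediv_succ_sub_ediv {B : ℤ} (hB : 0 < B) (y : ℤ) : (y + 1) / B - y / B = 0 ∨ (y + 1) / B - y / B = 1 := by
  have h1 : y / B ≤ (y + 1) / B := Int.ediv_le_ediv hB (by linarith)
  have h2 : (y + 1) / B < y / B + 2 := by
    rw [Int.ediv_lt_iff_lt_mul hB]
    have := Int.lt_ediv_add_one_mul_self y hB
    nlinarith
  omega

/-- `|⌊(y+r)/B⌋ − ⌊y/B⌋| ≤ 1` for `|r| ≤ 1`, `B ≥ 1`. -/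
theorem abs_ediv_add_sub_ediv_le {B : ℤ} (hB : 0 < B) (y : ℤ) {r : ℤ} (hr : |r| ≤ 1) : |(y + r) / B - y / B| ≤ 1 := by
  rw [abs_le] at hr ⊢
  have hr' : r = -1 ∨ r = 0 ∨ r = 1 := by omega
  rcases hr' with h | h | h
  · subst h
    have := ediv_succ_sub_ediv hB (y + -1)
    rw [show y + -1 + 1 = y by ring] at this
    omega
  · subst h; rw [add_zero, sub_self]; exact ⟨by norm_num, by norm_num⟩
  · subst h
    have := ediv_succ_sub_ediv hB y
    omega

/-- **ONE FINE STEP MOVES THE TOP CUBE BY AT MOST ONE (with wrap-around)**: if `x − x′` has circular size `≤ 1` modulo `B·K`,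
then `⌊x/B⌋ − ⌊x′/B⌋` has circular size `≤ 1` modulo `K`. -/
theorem circAbs_ediv_le_one {B K : ℕ} (hB : 1 ≤ B) (hK : 1 ≤ K) {x x' : ℤ} (h : circAbs (B * K) (x - x') ≤ 1) :
    circAbs K (x / B - x' / B) ≤ 1 := by
  have hB0 : (0 : ℤ) < B := by exact_mod_cast hB
  obtain ⟨m, hm⟩ := exists_abs_sub_mul_le_circAbs (n := B * K) (Nat.one_le_iff_ne_zero.2 (Nat.mul_ne_zero_iff.2
    ⟨by omega, by omega⟩)) (x - x')
  set r : ℤ := x - x' - (B * K : ℕ) * m with hr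
  have hr1 : |r| ≤ 1 := hm.trans h
  have hx : x = x' + r + (K * m) * B := by rw [hr]; push_cast; ring
  have hq : x / B = (x' + r) / B + K * m := by rw [hx, Int.add_mul_ediv_right _ _ hB0.ne']
  refine (circAbs_le_of_abs_sub_mul_le hK _ m).trans ?_
  rw [hq, show (x' + r) / ↑B + ↑K * m - x' / ↑B - ↑K * m = (x' + r) / B - x' / B by ring]
  exact abs_ediv_add_sub_ediv_le hB0 x' hr1

end Arith

/-! ## §2. The cube maps: fine sites and blocks of the torus ↦ top cubes of `UT Kc` -/

section Cubes

variable {ℓ Mh k R : ℕ} {P : Fin (d + 1) → ℕ}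

/-- A label `z : Fin (d+1) → ℤ` read as a point of the cube torus `UT Kc` (coordinatewise `z_μ mod Kc_μ` on the natural part). -/
def cubeOfLabel (Kc : Fin (d + 1) → ℕ) [∀ i, NeZero (Kc i)] (z : Fin (d + 1) → ℤ) : UT Kc :=
  UT.ofSite Kc fun i => Fin.ofNat (Kc i) (z i).toNat

/-- **The top cube of a fine site**: `x ↦ ⌊x/L^k⌋` read in `UT Kc` (the blocks of the top level `k` have side `L^k`).
[cite: Balaban1984PropagatorsII, (2.1) p.224] -/
def cubeML (ℓ k : ℕ) (Kc : Fin (d + 1) → ℕ) [∀ i, NeZero (Kc i)] (x : Fin (d + 1) → ℤ) : UT Kc :=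
  cubeOfLabel Kc (blk ((ℓ + 1) ^ k) x)

/-- **The top cube of a block** `(j, y)` (`y` = the label of a level-`j` block, side `L^j`): `⌊y/L^{k−j}⌋`.
[cite: Balaban1984PropagatorsII, (2.45) p.231] -/
def topOf (D : Domains d ℓ Mh k P R) (Kc : Fin (d + 1) → ℕ) [∀ i, NeZero (Kc i)] (s : ↥(bset D)) : UT Kc :=
  cubeOfLabel Kc (blk ((ℓ + 1) ^ (k - s.1.1)) s.1.2)

/-- **The canonical cube torus of the top blocks**: `N₀_μ = L^k·(L·M_h·P_μ)` (definitional for `B6MultiLevelBoxOperator.N0`),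
so `Kc_μ := L·M_h·P_μ` discharges the nesting hypothesis `hKc` of this file and its sequels by `rfl`.
[cite: Balaban1984PropagatorsII, (2.1) p.224, dictionary] -/
theorem N0_eq_pow_mul_topCount (i : Fin (d + 1)) : N0 ℓ Mh k P i = (ℓ + 1) ^ k * ((ℓ + 1) * (Mh * P i)) := rfl

/-- The canonical top-cube counts are nonzero for `M_h ≥ 1`, `P ≥ 1` (the `NeZero` instances `UT`∕`tdist1` need). -/
theorem neZero_topCount (hMh : 1 ≤ Mh) (hP : ∀ μ, 1 ≤ P μ) (i : Fin (d + 1)) : NeZero ((ℓ + 1) * (Mh * P i)) :=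
  ⟨Nat.mul_ne_zero_iff.2 ⟨by omega, Nat.mul_ne_zero_iff.2 ⟨by omega, by have := hP i; omega⟩⟩⟩

variable (D : Domains d ℓ Mh k P R) (Kc : Fin (d + 1) → ℕ) [∀ i, NeZero (Kc i)]

/-- **BLOCKS NEST INTO TOP CUBES**: the top cube of the block of `x` is the top cube of `x` (`L^j·L^{k−j} = L^k`, `j ≤ k`).
[cite: Balaban1984PropagatorsII, (2.1)–(2.4) p.224] -/
theorem topOf_blkOf (x : ↥(boxDom (N0 ℓ Mh k P))) : topOf D Kc (blkOf D x) = cubeML ℓ k Kc x.1 := by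
  have hj : D.lev x.1 ≤ k := D.lev_le x.1
  unfold topOf cubeML
  simp only [blkOf_val]
  rw [blk_blk, ← pow_add, Nat.add_sub_cancel' hj]

variable {D Kc}

/-- Inside the fundamental box with `N₀ = L^k·Kc` the top cube coordinate is `⌊x_μ/L^k⌋` itself (no wrap). -/
theorem cubeML_val (hKc : ∀ i, N0 ℓ Mh k P i = (ℓ + 1) ^ k * Kc i) {x : Fin (d + 1) → ℤ} (hx : x ∈ boxDom (N0 ℓ Mh k P))
    (i : Fin (d + 1)) : (((UT.toSite Kc (cubeML ℓ k Kc x)) i : ℕ) : ℤ) = x i / ((ℓ + 1) ^ k : ℕ) := by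
  have hL : (0 : ℤ) < ((ℓ + 1) ^ k : ℕ) := by positivity
  obtain ⟨h0, h1⟩ := (mem_boxDom.1 hx) i
  rw [hKc i] at h1
  push_cast at h1
  have hq0 : 0 ≤ x i / ((ℓ + 1) ^ k : ℕ) := Int.ediv_nonneg h0 hL.le
  have hq1 : x i / ((ℓ + 1) ^ k : ℕ) < Kc i := by
    rw [Int.ediv_lt_iff_lt_mul hL]; push_cast; linarith
  have hnat : ((x i / ((ℓ + 1) ^ k : ℕ)).toNat : ℤ) = x i / ((ℓ + 1) ^ k : ℕ) := Int.toNat_of_nonneg hq0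
  have hlt : (x i / ((ℓ + 1) ^ k : ℕ)).toNat < Kc i := by omega
  unfold cubeML cubeOfLabel blk
  simp only [UT.toSite_ofSite, Fin.ofNat, Nat.mod_eq_of_lt hlt]
  exact hnat

end Cubes

/-! ## §3. `d₁ ≤ (d+1)·d_T`: touching blocks have touching top cubes; induction along admissible contours -/

section Distances

variable {ℓ Mh k R : ℕ} {P : Fin (d + 1) → ℕ} {Kc : Fin (d + 1) → ℕ} [∀ i, NeZero (Kc i)]

/-- **Fine sites at torus sup-distance `≤ 1` have top cubes at ℓ¹ distance `≤ d + 1`** (each of the `d + 1` cube coordinates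
moves by at most one, with wrap-around: `circAbs_ediv_le_one`). -/
theorem tdist1_cubeML_le_of_torusSupNorm_le_one (hKc : ∀ i, N0 ℓ Mh k P i = (ℓ + 1) ^ k * Kc i)
    {x x' : Fin (d + 1) → ℤ} (hx : x ∈ boxDom (N0 ℓ Mh k P)) (hx' : x' ∈ boxDom (N0 ℓ Mh k P))
    (h : torusSupNorm (N0 ℓ Mh k P) (x - x') ≤ 1) :
    tdist1 Kc (cubeML ℓ k Kc x) (cubeML ℓ k Kc x') ≤ (d : ℝ) + 1 := by
  have hK1 : ∀ i, 1 ≤ Kc i := fun i => Nat.one_le_iff_ne_zero.2 (NeZero.ne _)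
  have hcoord : ∀ i, (ccoord Kc (UT.toSite Kc (cubeML ℓ k Kc x)) (UT.toSite Kc (cubeML ℓ k Kc x')) i : ℝ) ≤ 1 := by
    intro i
    have hci : ((circAbs (N0 ℓ Mh k P i) ((x - x') i) : ℤ) : ℝ) ≤ 1 :=
      le_trans (Finset.le_sup' (fun i => ((circAbs (N0 ℓ Mh k P i) ((x - x') i) : ℤ) : ℝ)) (Finset.mem_univ i)) h
    have hci' : circAbs ((ℓ + 1) ^ k * Kc i) (x i - x' i) ≤ 1 := by
      rw [← hKc i]; exact_mod_cast hci
    have hstep := circAbs_ediv_le_one (Nat.one_le_pow _ _ (by omega)) (hK1 i) hci'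
    have hcast := ccoord_cast hK1 (UT.toSite Kc (cubeML ℓ k Kc x)) (UT.toSite Kc (cubeML ℓ k Kc x')) i
    rw [cubeML_val hKc hx, cubeML_val hKc hx'] at hcast
    have : (ccoord Kc (UT.toSite Kc (cubeML ℓ k Kc x)) (UT.toSite Kc (cubeML ℓ k Kc x')) i : ℤ) ≤ 1 := by
      rw [hcast]; exact hstep
    exact_mod_cast this
  unfold tdist1
  calc ∑ i, (ccoord Kc (UT.toSite Kc (cubeML ℓ k Kc x)) (UT.toSite Kc (cubeML ℓ k Kc x')) i : ℝ)
      ≤ ∑ _i : Fin (d + 1), (1 : ℝ) := Finset.sum_le_sum fun i _ => hcoord i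
    _ = (d : ℝ) + 1 := by simp

variable {D : TDomains d ℓ Mh k P R}

/-- **Touching blocks have top cubes at `d₁ ≤ d + 1`.** [cite: Balaban1984PropagatorsII, (2.46) p.231 (admissible bonds)] -/
theorem tdist1_topOf_le_of_touchT (hKc : ∀ i, N0 ℓ Mh k P i = (ℓ + 1) ^ k * Kc i) {s t : ↥(bset D.toDomains)}
    (h : TouchT D s t) : tdist1 Kc (topOf D.toDomains Kc s) (topOf D.toDomains Kc t) ≤ (d : ℝ) + 1 := by
  obtain ⟨x, x', hx, hx', hd⟩ := h
  rw [← hx, ← hx', topOf_blkOf, topOf_blkOf]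
  exact tdist1_cubeML_le_of_torusSupNorm_le_one hKc x.2 x'.2 hd

/-- An admissible bond moves the top cube by `d₁ ≤ d + 1`. [cite: Balaban1984PropagatorsII, (2.46) p.231] -/
theorem tdist1_topOf_le_of_adj (hKc : ∀ i, N0 ℓ Mh k P i = (ℓ + 1) ^ k * Kc i) {s t : ↥(bset D.toDomains)}
    (h : (bondT D).Adj s t) : tdist1 Kc (topOf D.toDomains Kc s) (topOf D.toDomains Kc t) ≤ (d : ℝ) + 1 :=
  tdist1_topOf_le_of_touchT hKc (bondT_adj.1 h).2

/-- Along an admissible contour of `n` bonds the top cube moves by `d₁ ≤ (d+1)·n`. [cite: Balaban1984PropagatorsII, (2.46) p.231] -/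
theorem tdist1_topOf_le_length (hKc : ∀ i, N0 ℓ Mh k P i = (ℓ + 1) ^ k * Kc i) {s t : ↥(bset D.toDomains)}
    (p : (bondT D).Walk s t) :
    tdist1 Kc (topOf D.toDomains Kc s) (topOf D.toDomains Kc t) ≤ ((d : ℝ) + 1) * p.length := by
  induction p with
  | nil => rw [tdist1_self]; simp
  | @cons a b c hab q ih =>
    rw [SimpleGraph.Walk.length_cons, Nat.cast_succ]
    calc tdist1 Kc (topOf D.toDomains Kc a) (topOf D.toDomains Kc c)
        ≤ tdist1 Kc (topOf D.toDomains Kc a) (topOf D.toDomains Kc b) + tdist1 Kc (topOf D.toDomains Kc b)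
            (topOf D.toDomains Kc c) := tdist1_triangle _ _ _
      _ ≤ ((d : ℝ) + 1) + ((d : ℝ) + 1) * q.length := add_le_add (tdist1_topOf_le_of_adj hKc hab) ih
      _ = ((d : ℝ) + 1) * (q.length + 1) := by ring

/-- **`d₁(topOf s, topOf t) ≤ (d+1)·d_T(s,t)`**: the cube torus' ℓ¹ distance between the top cubes is dominated by the
multiscale distance (2.46) of `geomT D` (the bond graph is connected: `connectedT`). [cite: Balaban1984PropagatorsII, (2.46) p.231, (2.54) p.233] -/
theorem tdist1_topOf_le_dist (hMh : 1 ≤ Mh) (hP : ∀ μ, 1 ≤ P μ) (hKc : ∀ i, N0 ℓ Mh k P i = (ℓ + 1) ^ k * Kc i)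
    (s t : ↥(bset D.toDomains)) :
    tdist1 Kc (topOf D.toDomains Kc s) (topOf D.toDomains Kc t) ≤ ((d : ℝ) + 1) * (geomT D).dist s t := by
  obtain ⟨p, hp⟩ := (connectedT (D := D) hMh hP).exists_walk_length_eq_dist s t
  have h := tdist1_topOf_le_length hKc p
  rw [hp] at h
  exact h

/-- **The exponential form**: `e^{−δ·d_T(s,t)} ≤ e^{−(δ/(d+1))·d₁(topOf s, topOf t)}` for `δ ≥ 0` — a decaying block majorant
on `geomT D` decays in the cube torus at the rate `δ/(d+1)`. [cite: Balaban1984PropagatorsII, (2.46) p.231, Prop. 2.2 (2.67) p.234] -/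
theorem exp_neg_dist_le (hMh : 1 ≤ Mh) (hP : ∀ μ, 1 ≤ P μ) (hKc : ∀ i, N0 ℓ Mh k P i = (ℓ + 1) ^ k * Kc i)
    {δ : ℝ} (hδ : 0 ≤ δ) (s t : ↥(bset D.toDomains)) :
    Real.exp (-(δ * (geomT D).dist s t)) ≤
      Real.exp (-(δ / ((d : ℝ) + 1) * tdist1 Kc (topOf D.toDomains Kc s) (topOf D.toDomains Kc t))) := by
  rw [Real.exp_le_exp, neg_le_neg_iff]
  have hd1 : (0 : ℝ) < (d : ℝ) + 1 := by positivity
  have h := tdist1_topOf_le_dist (D := D) hMh hP hKc s t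
  calc δ / ((d : ℝ) + 1) * tdist1 Kc (topOf D.toDomains Kc s) (topOf D.toDomains Kc t)
      ≤ δ / ((d : ℝ) + 1) * (((d : ℝ) + 1) * (geomT D).dist s t) := mul_le_mul_of_nonneg_left h (by positivity)
    _ = δ * (geomT D).dist s t := by field_simp

end Distances

end Summit.QuantumFields.BalabanUV.Gaps.D4WalkBlockMultiLevelGeometry

end
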